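import Literature.MathematicalPhysics.QuantumFieldTheory.ConformalBootstrap3D.PointKernelK34v2Data
import Literature.MathematicalPhysics.QuantumFieldTheory.ConformalBootstrap3D.PointKernelParts

/-!
# K34v2 certificate, kernel part file P24: one-cell head segments 142, 143 in level ranges

The head cells whose kernel evaluation exceeds one `decide` are one-cell segments of `hsegsK34v2`; each is
checked by `PCert.hPartSideOK` (side conditions) and `PCert.hPartOK` per level range `[n_lo, n_lo + count)`
against an integer claim, the claims summing to `≥ 0` (`PointKernel.partsOK`); soundness is
`PCert.hParts_sound` (`PointKernelParts`).  The part files `P1, P2, …` are mutually independent (each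
imports only the data file); the ranges of one cell may span several of them, and the per-cell
conclusions `hparts_i` / `hcell_i` of those cells are assembled in `PointKernelK34v2.lean`.
Estimated kernel time 242 s.
-/

set_option maxRecDepth 100000
set_option maxHeartbeats 0

namespace Literature.MathematicalPhysics.QuantumFieldTheory.ConformalBootstrap3D.PointKernelK34v2

open Literature.MathematicalPhysics.QuantumFieldTheory.ConformalBootstrap3D.PointKernel

/-- levels `[68, 71)` of segment 142: partial lower sum `≥` claim. [folklore] -/
theorem part_142_8 : certK34v2.hPartOK (PCert.segAt hsegsK34v2 142) JHK34v2 68 3 (110883423270581941598670367051447305) = true := by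
  decide +kernel

/-- levels `[71, 73)` of segment 142: partial lower sum `≥` claim. [folklore] -/
theorem part_142_9 : certK34v2.hPartOK (PCert.segAt hsegsK34v2 142) JHK34v2 71 2 (42717642917802476279912890956490706) = true := by
  decide +kernel

/-- one-cell segment 143 (row 6, cell `[7169/1024, 28677/4096]`, chord, `n_F = 72`,
10 level ranges): side conditions. [folklore] -/
theorem pside_143 : certK34v2.hPartSideOK (PCert.segAt hsegsK34v2 143) JHK34v2 = true := by
  decide +kernel

/-- its level ranges `(n_lo, count, claim)`. [folklore] -/
def parts_143 : List (ℕ × ℕ × ℤ) := [(0, 25, -43104474620028567704615595511410392844), (25, 11, 27491677102116085463882480843034643142), (36, 8, 9192203667051350257554850258278727554), (44, 6, 3308362028815673687492592447980393538), (50, 5, 1495394782781071875667273676439055966), (55, 5, 847268173339191201171555143642164982), (60, 4, 391593357361076676435127329106264901), (64, 4, 238342721555833724961765372386834224), (68, 3, 103904827354371853861320071694288693), (71, 2, 35727959653912963588630368848019848)]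

/-- the ranges tile `[0, n_F]` and the claims sum to `≥ 0`. [folklore] -/
theorem pcov_143 : PointKernel.partsOK 72 parts_143 = true := by
  decide +kernel

/-- levels `[0, 25)` of segment 143: partial lower sum `≥` claim. [folklore] -/
theorem part_143_0 : certK34v2.hPartOK (PCert.segAt hsegsK34v2 143) JHK34v2 0 25 (-43104474620028567704615595511410392844) = true := by
  decide +kernel

/-- levels `[25, 36)` of segment 143: partial lower sum `≥` claim. [folklore] -/
theorem part_143_1 : certK34v2.hPartOK (PCert.segAt hsegsK34v2 143) JHK34v2 25 11 (27491677102116085463882480843034643142) = true := by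
  decide +kernel

end Literature.MathematicalPhysics.QuantumFieldTheory.ConformalBootstrap3D.PointKernelK34v2
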